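import Literature.MathematicalPhysics.QuantumFieldTheory.Balaban1983to89.Node00.TwoRunSitePeierlsCoverFamily

/-!
# NODE 00 — SKELETONS OF LARGE-FIELD COMPONENTS: a touching component of `≥ m·k` points contains `k` pairwise SEPARATED points (for an abstract closeness `Nr`
# of covering number `m`) that are CONNECTED for the skeleton adjacency «some `Nr`-neighbours touch» (`SkelTouch τ Nr`); the separated skeleton animals form a finite
# family of `≤ |α| · (m·D·m)^{2(k−1)}` members (`D` = the covering number of `τ`) — the cover a Peierls bound with ONE factor per SEPARATED block consumes

Cell `pub-ymgap`, YM-PLAN Track A (HUMAN RULING D-0062; width push D-0149); seat `pub-ymgap-dag-n20-d` (R134 (a) N20 NE7b s3 = the U5d ∕ `crOfRecord₁₃` lineage,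
its declarer) gen 34 — companion of `Node00/TwoRunSitePeierlsCover` (`touchingGraph`, `ConnIn` ∕ `compIn` ∕ `HasBigComponent`, `exists_connected_finset_of_hasBigComponent`)
and `Node00/TwoRunSitePeierlsCoverFamily` (`animalCoverFamily`, `card_animalCoverFamily_le`, `exists_mem_animalCoverFamily_subset_of_hasBigComponent`).
[LF-II] = [Balaban1989LargeFieldII]; [III] = [Balaban1988Convergent].

WHY (located, numbers not adjectives).  The block-grain Peierls assembly of gen 33 (`Summits/…/BalabanUVNodesSpineReadingOfRecord13CoPHKComponentSizeBlocks{,Inside}`)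
asks its supplier for ONE small factor `δ ≤ 1∕12800` per block of a TOUCHING animal inside the level-`j` large-field region `Z_j`.  Bałaban's regions carry the LAYER
CALCULUS: a new region is the `2`-layer enlargement of the cubes where a large field is met ([LF-II] (1.76) p. 381: «`Z ⊂ ⋃ᵢ (Zᵢ⁰)^{∼2}`»), an old component `Z` re-enters
the next region as `S(Z) = Z′^{∼10}` ([LF-II] p. 384: «we take the cover `Z′` of `Z` by a smallest union of `LMR_{j+1}`-cubes, and we add ten layers of such cubes»).  So,
given ONE genuine large-field cube, every block of its enlargement lies in `Z_j` with conditional weight `1`: adjacent blocks of an animal cannot each pay `δ`.  Only blocks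
whose enlargement neighbourhoods are DISJOINT can — and print's own bookkeeping is of that kind: (1.84)–(1.88) pp. 386–387 is an induction over a TREE GRAPH whose vertices are
DOMAINS and whose lines join domains that «intersect, or touch each other» (p. 386), one factor per domain.  THE REPAIR, typed here as pure combinatorics: a SKELETON.
For an abstract reflexive symmetric closeness `Nr` on the points (e.g. «sup-distance `≤ 2ϱ`», `ϱ` the enlargement radius in blocks) with covering number `m` (every
`Nr`-neighbourhood has `≤ m` points):
* §1 `exists_indep_dominating_subset` — every finite `C` has a pairwise `Nr`-SEPARATED subset `B` that `Nr`-DOMINATES `C` (a separated subset of maximal size), hence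
  `#C ≤ m · #B`;
* §2 `SkelTouch τ Nr x y :↔ ∃ c c′, Nr c x ∧ τ c c′ ∧ Nr c′ y` (print's «the corresponding domains intersect, or touch»), ★ `connIn_skelTouch_of_connIn` (a touching chain inside
  a set dominated by `B` LIFTS to a `SkelTouch`-chain inside `B` — `Relation.ReflTransGen` induction; `τ` reflexive), `subset_compIn_skelTouch`, ★★
  `exists_mem_sepAnimalCoverFamily_of_hasBigComponent` — a region `Z` with a `τ`-component of `≥ m·k` points (`k ≥ 1`) contains the point set of a member of the finite family
  `sepAnimalCoverFamily τ Nr k` of pairs `(z, S)`, `S ∋ z` a `SkelTouch`-connected `k`-set, pairwise `Nr`-separated;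
* §3 `degree_touchingGraph_skelTouch_le` (`≤ m·D·m`, `D` a covering number of `τ`-neighbourhoods), ★ `card_sepAnimalCoverFamily_le` (`≤ |α| · (m·D·m)^{2(k−1)}`,
  `card_animalCoverFamily_le` BY NAME);
* §4 the torus instances: `exists_cover_siteTouch` (`D = 3^d` for `SiteTouch`, the translates by `{0, ±1}^d`), `exists_mem_sepAnimalCoverFamily_siteTouch_of_hasBigComponent`.
The consumer (`Summits/…/BalabanUVNodesSpineReadingOfRecord13CoPHKComponentSizeBlocksSkeleton`, gen 34) runs Peierls on this family: entropy `(m·3^d·m)^{2(k−1)}` per base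
point against ONE letter `θ` per SEPARATED block (`2·(m·3^d·m)²·θ ≤ 1`), polynomial in `m` — instead of `δ^{1∕m}` per touching block.
HONEST — WHAT THIS IS NOT.  Pure finite combinatorics (two `def`s: a relation and a classical `Finset.filter`; theorems); NO weight, NO measure, NO estimate; the closeness
`Nr`, its radius and Bałaban's enlargement constants are NOT instantiated here (abstract hypotheses `hrefl ∕ hsymm ∕ hm`); nothing of Bałaban's asserted; NE7 ∕ NE7b ∕ NE7c
NOT PRINTED for `d = 4` and NOT proved; no node count moves (typed 28∕28 · discharged 8∕27); no `sorry`, no `axiom`, no `instance`, no `notation`; one finite four-torus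
programme at fixed `ε` — NOT ℝ⁴, NOT OS, NOT a mass gap, NOT the Clay problem.
-/

noncomputable section

open scoped BigOperators

namespace Literature.MathematicalPhysics.QuantumFieldTheory.Balaban1983to89.Node00

open T4Continuum B14.Eq213MaximalDomains B15Eq112TorusCover B14DomainGeom B14.Eq218Concrete

/-! ## §1  Separated dominating subsets (packing by a closeness of bounded covering number) -/

section Packing

variable {α : Type*} [DecidableEq α] (Nr : α → α → Prop)

/-- ★ **A SEPARATED DOMINATING SUBSET** [folklore]: for a reflexive symmetric closeness `Nr` whose neighbourhoods have at most `m` points, every finite set `C` contains a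
pairwise `Nr`-separated subset `B` such that every point of `C` is `Nr`-close to a point of `B` (a separated subset of MAXIMAL SIZE is maximal, hence dominating), and then
`#C ≤ m · #B` (the `Nr`-neighbourhoods of `B` cover `C`).  Print's domains of a tree graph are of this kind: distinct vertices are distinct domains, each met by boundedly many
others. [cite: Balaban1989LargeFieldII, (1.84) p.386 (bookkeeping)] -/
theorem exists_indep_dominating_subset (hrefl : ∀ a, Nr a a) (hsymm : ∀ a b, Nr a b → Nr b a)
    {m : ℕ} (hm : ∀ b, ∃ s : Finset α, s.card ≤ m ∧ ∀ c, Nr c b → c ∈ s) (C : Finset α) :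
    ∃ B : Finset α, B ⊆ C ∧ (∀ b ∈ B, ∀ b' ∈ B, b ≠ b' → ¬ Nr b b') ∧ (∀ c ∈ C, ∃ b ∈ B, Nr c b) ∧ C.card ≤ m * B.card := by
  classical
  set I : Finset (Finset α) := C.powerset.filter (fun T => ∀ b ∈ T, ∀ b' ∈ T, b ≠ b' → ¬ Nr b b') with hI
  have hne : I.Nonempty := ⟨∅, by simp [hI]⟩
  obtain ⟨B, hBI, hBmax⟩ := Finset.exists_max_image I Finset.card hne
  rw [hI, Finset.mem_filter, Finset.mem_powerset] at hBI
  obtain ⟨hBC, hBind⟩ := hBI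
  -- domination, by maximality of the size
  have hdom : ∀ c ∈ C, ∃ b ∈ B, Nr c b := by
    intro c hc
    by_contra h0
    have h : ∀ b ∈ B, ¬ Nr c b := fun b hb hcb => h0 ⟨b, hb, hcb⟩
    have hcB : c ∉ B := fun hcB => h c hcB (hrefl c)
    have hins : insert c B ∈ I := by
      rw [hI, Finset.mem_filter, Finset.mem_powerset]
      refine ⟨Finset.insert_subset hc hBC, ?_⟩
      intro b hb b' hb' hne'
      rw [Finset.mem_insert] at hb hb'
      rcases hb with hbc | hbB
      · rcases hb' with hb'c | hb'B
        · exact absurd (hbc.trans hb'c.symm) hne'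
        · rw [hbc]
          exact h b' hb'B
      · rcases hb' with hb'c | hb'B
        · rw [hb'c]
          exact fun hbc' => h b hbB (hsymm _ _ hbc')
        · exact hBind b hbB b' hb'B hne'
    have hle := hBmax _ hins
    rw [Finset.card_insert_of_notMem hcB] at hle
    omega
  refine ⟨B, hBC, hBind, hdom, ?_⟩
  -- counting: `C` is covered by the `Nr`-neighbourhoods of the points of `B`
  choose s hs using hm
  have hcov : C ⊆ B.biUnion fun b => s b := by
    intro c hc
    obtain ⟨b, hb, hcb⟩ := hdom c hc
    exact Finset.mem_biUnion.2 ⟨b, hb, (hs b).2 c hcb⟩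
  calc C.card ≤ (B.biUnion fun b => s b).card := Finset.card_le_card hcov
    _ ≤ ∑ b ∈ B, (s b).card := Finset.card_biUnion_le
    _ ≤ ∑ _b ∈ B, m := Finset.sum_le_sum fun b _ => (hs b).1
    _ = m * B.card := by rw [Finset.sum_const, smul_eq_mul, mul_comm]

omit [DecidableEq α] in
/-- A reflexive closeness has covering number `m ≥ 1`. [cite: Balaban1989LargeFieldII, (1.84) p.386 (bookkeeping)] -/
theorem one_le_of_cover (hrefl : ∀ a, Nr a a) {m : ℕ} (hm : ∀ b, ∃ s : Finset α, s.card ≤ m ∧ ∀ c, Nr c b → c ∈ s) (a : α) : 1 ≤ m := by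
  obtain ⟨s, hs, hs'⟩ := hm a
  exact (Finset.card_pos.2 ⟨a, hs' a (hrefl a)⟩).trans_le hs

end Packing

/-! ## §2  The skeleton adjacency and the lifting of touching chains -/

section Skeleton

variable {α : Type*} (τ Nr : α → α → Prop)

/-- **THE SKELETON ADJACENCY** of a touching relation `τ` seen through a closeness `Nr`: `x` and `y` are skeleton-adjacent iff some point `Nr`-close to `x` touches some
point `Nr`-close to `y` — print's «a pair of domains is a line in `G` if the union of corresponding domains … is a connected domain, i.e., if the corresponding domains
intersect, or touch each other». [cite: Balaban1989LargeFieldII, (1.84) p.386 (bookkeeping)] -/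
def SkelTouch (x y : α) : Prop :=
  ∃ c c', Nr c x ∧ τ c c' ∧ Nr c' y

/-- Unfolding. [cite: Balaban1989LargeFieldII, (1.84) p.386 (bookkeeping)] -/
theorem skelTouch_iff (x y : α) : SkelTouch τ Nr x y ↔ ∃ c c', Nr c x ∧ τ c c' ∧ Nr c' y := Iff.rfl

/-- Close points are skeleton-adjacent when `τ` is reflexive. [cite: Balaban1989LargeFieldII, (1.84) p.386 (bookkeeping)] -/
theorem skelTouch_of_near (hτ : ∀ a, τ a a) {x y c : α} (hx : Nr c x) (hy : Nr c y) : SkelTouch τ Nr x y :=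
  ⟨c, c, hx, hτ c, hy⟩

/-- ★ **TOUCHING CHAINS LIFT TO SKELETON CHAINS** (`τ` reflexive): if every point `τ`-connected to `z₀` inside `Z` is `Nr`-close to some point of `B`, `b₀ ∈ B` is close to
`z₀`, and `c` is `τ`-connected to `z₀` inside `Z`, then every `b ∈ B` close to `c` is `SkelTouch`-connected to `b₀` INSIDE `B` (induction along the chain: consecutive
points' dominators are skeleton-adjacent through the touching pair). [cite: Balaban1989LargeFieldII, (1.84)–(1.86) pp.386–387 (bookkeeping)] -/
theorem connIn_skelTouch_of_connIn (hτ : ∀ a, τ a a) {Z : Set α} {z₀ : α} {B : Set α}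
    (hdom : ∀ c, ConnIn τ Z z₀ c → ∃ b ∈ B, Nr c b) {b₀ : α} (hb₀ : b₀ ∈ B) (hzb₀ : Nr z₀ b₀)
    {c : α} (hc : ConnIn τ Z z₀ c) : ∀ ⦃b : α⦄, b ∈ B → Nr c b → ConnIn (SkelTouch τ Nr) B b₀ b := by
  induction hc with
  | refl =>
    intro b hb hcb
    exact Relation.ReflTransGen.single ⟨hb₀, hb, z₀, z₀, hzb₀, hτ z₀, hcb⟩
  | tail hzc hcc' ih =>
    rename_i c c'
    intro b hb hcb
    obtain ⟨b₁, hb₁, hcb₁⟩ := hdom c hzc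
    exact (ih hb₁ hcb₁).tail ⟨hb₁, hb, c, c', hcb₁, hcc'.2.2, hcb⟩

/-- **A DOMINATING SUBSET OF A COMPONENT LIES IN ONE SKELETON COMPONENT OF ITSELF** (`τ`, `Nr` reflexive): if `B ⊆ compIn τ Z z₀` dominates that component and `b₀ ∈ B` is
close to `z₀`, then `B ⊆ compIn (SkelTouch τ Nr) B b₀`. [cite: Balaban1989LargeFieldII, (1.84)–(1.86) pp.386–387 (bookkeeping)] -/
theorem subset_compIn_skelTouch (hτ : ∀ a, τ a a) (hNr : ∀ a, Nr a a) {Z : Set α} {z₀ : α} {B : Set α}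
    (hBZ : B ⊆ compIn τ Z z₀) (hdom : ∀ c ∈ compIn τ Z z₀, ∃ b ∈ B, Nr c b) {b₀ : α} (hb₀ : b₀ ∈ B) (hzb₀ : Nr z₀ b₀) :
    B ⊆ compIn (SkelTouch τ Nr) B b₀ := fun b hb =>
  (mem_compIn_iff (SkelTouch τ Nr) B b₀ b).2
    (connIn_skelTouch_of_connIn τ Nr hτ (fun c hc => hdom c ((mem_compIn_iff τ Z z₀ c).2 hc)) hb₀ hzb₀
      ((mem_compIn_iff τ Z z₀ b).1 (hBZ hb)) hb (hNr b))

variable [Fintype α] [DecidableEq α]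

open scoped Classical in
/-- **THE SEPARATED SKELETON COVER FAMILY**: the members `(z, S)` of `animalCoverFamily (SkelTouch τ Nr) k` (`S ∋ z` a skeleton-connected `k`-set) whose points are
pairwise `Nr`-SEPARATED. [cite: Balaban1989LargeFieldII, (1.84) p.386 (bookkeeping)] -/
def sepAnimalCoverFamily (k : ℕ) : Finset (α × Finset α) :=
  (animalCoverFamily (SkelTouch τ Nr) k).filter fun p => ∀ b ∈ p.2, ∀ b' ∈ p.2, b ≠ b' → ¬ Nr b b'

/-- Membership. [cite: Balaban1989LargeFieldII, (1.84) p.386 (bookkeeping)] -/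
theorem mem_sepAnimalCoverFamily_iff (k : ℕ) (p : α × Finset α) :
    p ∈ sepAnimalCoverFamily τ Nr k ↔ p ∈ animalCoverFamily (SkelTouch τ Nr) k ∧ ∀ b ∈ p.2, ∀ b' ∈ p.2, b ≠ b' → ¬ Nr b b' := by
  classical
  unfold sepAnimalCoverFamily
  rw [Finset.mem_filter]

/-- The separated family is a sub-family of the skeleton cover family. [cite: Balaban1989LargeFieldII, (1.84) p.386 (bookkeeping)] -/
theorem sepAnimalCoverFamily_subset (k : ℕ) : sepAnimalCoverFamily τ Nr k ⊆ animalCoverFamily (SkelTouch τ Nr) k := fun p hp =>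
  ((mem_sepAnimalCoverFamily_iff τ Nr k p).1 hp).1

/-- Members are separated `k`-sets through their base point. [cite: Balaban1989LargeFieldII, (1.84) p.386 (bookkeeping)] -/
theorem card_eq_of_mem_sepAnimalCoverFamily {k : ℕ} {p : α × Finset α} (hp : p ∈ sepAnimalCoverFamily τ Nr k) :
    p.2.card = k ∧ ∀ b ∈ p.2, ∀ b' ∈ p.2, b ≠ b' → ¬ Nr b b' :=
  ⟨((mem_animalCoverFamily_iff' (SkelTouch τ Nr) k p).1 ((mem_sepAnimalCoverFamily_iff τ Nr k p).1 hp).1).2.1, ((mem_sepAnimalCoverFamily_iff τ Nr k p).1 hp).2⟩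

/-- ★★ **THE SKELETON COVER**: for `τ` reflexive and `Nr` reflexive symmetric of covering number `m`, a region `Z` with a `τ`-component on which `big` holds, where `big C`
forces `m·k ≤ |C|` (`k ≥ 1`), contains the point set of some member of `sepAnimalCoverFamily τ Nr k`: a maximal separated subset `B` of the component dominates it
(§1), so it has `≥ k` points and lies in ONE skeleton component of itself (`subset_compIn_skelTouch`); a skeleton-connected `k`-subset through a point
(`exists_mem_animalCoverFamily_subset_of_hasBigComponent` BY NAME) is still separated. [cite: Balaban1989LargeFieldII, (1.84)–(1.88) pp.386–387 (bookkeeping)] -/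
theorem exists_mem_sepAnimalCoverFamily_of_hasBigComponent (hτ : ∀ a, τ a a) (hrefl : ∀ a, Nr a a) (hsymm : ∀ a b, Nr a b → Nr b a)
    {m : ℕ} (hm : ∀ b, ∃ s : Finset α, s.card ≤ m ∧ ∀ c, Nr c b → c ∈ s) {k : ℕ} (hk : 1 ≤ k)
    {big : Set α → Prop} (hbig : ∀ C : Set α, big C → m * k ≤ C.ncard) {Z : Set α} (h : HasBigComponent τ big Z) :
    ∃ p ∈ sepAnimalCoverFamily τ Nr k, (↑p.2 : Set α) ⊆ Z := by
  classical
  obtain ⟨z₀, hz₀, hbigC⟩ := (hasBigComponent_iff τ big Z).1 h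
  set C : Finset α := (compIn τ Z z₀).toFinset with hC
  have hCset : (C : Set α) = compIn τ Z z₀ := by rw [hC, Set.coe_toFinset]
  obtain ⟨B, hBC, hBind, hdom, hcard⟩ := exists_indep_dominating_subset Nr hrefl hsymm hm C
  -- size: `m·k ≤ #C ≤ m·#B`, so `k ≤ #B`
  have hmk : m * k ≤ C.card := by
    have h1 := hbig _ hbigC
    rwa [Set.ncard_eq_toFinset_card' (compIn τ Z z₀), ← hC] at h1
  have hkB : k ≤ B.card := Nat.le_of_mul_le_mul_left (hmk.trans hcard) (one_le_of_cover Nr hrefl hm z₀)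
  -- the dominator of `z₀`
  have hz₀C : z₀ ∈ C := by
    rw [hC, Set.mem_toFinset]
    exact mem_compIn_self τ Z z₀
  obtain ⟨b₀, hb₀, hzb₀⟩ := hdom z₀ hz₀C
  -- `B` lies in the skeleton component of `b₀` inside `B`
  have hBcomp : (↑B : Set α) ⊆ compIn τ Z z₀ := fun b hb => by
    rw [← hCset]
    exact hBC hb
  have hBsub : (↑B : Set α) ⊆ compIn (SkelTouch τ Nr) ↑B b₀ :=
    subset_compIn_skelTouch τ Nr hτ hrefl hBcomp (fun c hc => hdom c (by rw [hC, Set.mem_toFinset]; exact hc)) hb₀ hzb₀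
  have hbigB : HasBigComponent (SkelTouch τ Nr) (bigOfCard (fun _ => k) 0) (↑B : Set α) := by
    refine (hasBigComponent_iff (SkelTouch τ Nr) _ _).2 ⟨b₀, hb₀, ?_⟩
    rw [bigOfCard_iff]
    calc k ≤ B.card := hkB
      _ = (↑B : Set α).ncard := (Set.ncard_coe_finset B).symm
      _ ≤ (compIn (SkelTouch τ Nr) ↑B b₀).ncard := Set.ncard_le_ncard hBsub (Set.toFinite _)
  obtain ⟨p, hp, hpB⟩ := exists_mem_animalCoverFamily_subset_of_hasBigComponent (SkelTouch τ Nr) (m := fun _ => k) (j := 0) hk hbigB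
  have hpB' : p.2 ⊆ B := Finset.coe_subset.1 hpB
  refine ⟨p, (mem_sepAnimalCoverFamily_iff τ Nr k p).2 ⟨hp, fun b hb b' hb' hne => hBind b (hpB' hb) b' (hpB' hb') hne⟩, ?_⟩
  exact hpB.trans (hBcomp.trans (compIn_subset τ hz₀))

/-- ★★ … in the cardinality-threshold form of the K-kit (`bigOfCard thr lvl`, any level tag, thresholds `thr lvl ≥ m·k`). [cite: Balaban1989LargeFieldII, (1.84)–(1.88) pp.386–387 (bookkeeping)] -/
theorem exists_mem_sepAnimalCoverFamily_of_hasBigComponent_card (hτ : ∀ a, τ a a) (hrefl : ∀ a, Nr a a) (hsymm : ∀ a b, Nr a b → Nr b a)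
    {m : ℕ} (hm : ∀ b, ∃ s : Finset α, s.card ≤ m ∧ ∀ c, Nr c b → c ∈ s) {k : ℕ} (hk : 1 ≤ k)
    {thr : ℕ → ℕ} {lvl : ℕ} (hthr : m * k ≤ thr lvl) {Z : Set α} (h : HasBigComponent τ (bigOfCard thr lvl) Z) :
    ∃ p ∈ sepAnimalCoverFamily τ Nr k, (↑p.2 : Set α) ⊆ Z :=
  exists_mem_sepAnimalCoverFamily_of_hasBigComponent τ Nr hτ hrefl hsymm hm hk (big := bigOfCard thr lvl)
    (fun C hC => hthr.trans ((bigOfCard_iff thr lvl C).1 hC)) h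

end Skeleton

/-! ## §3  The entropy of the skeleton family -/

section Entropy

variable {α : Type*} [Fintype α] [DecidableEq α] (τ Nr : α → α → Prop)

/-- **THE SKELETON GRAPH HAS DEGREE `≤ m·D·m`** when every `Nr`-neighbourhood has `≤ m` points (`Nr` symmetric) and every two-sided `τ`-neighbourhood `≤ D` points: a
skeleton neighbour of `a` is close to a point touching a point close to `a`. [cite: Balaban1989LargeFieldII, (1.84) p.386 (bookkeeping)] -/
theorem degree_touchingGraph_skelTouch_le [DecidableRel (touchingGraph (SkelTouch τ Nr)).Adj] (hsymm : ∀ a b, Nr a b → Nr b a) {m D : ℕ}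
    (hm : ∀ b, ∃ s : Finset α, s.card ≤ m ∧ ∀ c, Nr c b → c ∈ s) (hD : ∀ c, ∃ s : Finset α, s.card ≤ D ∧ ∀ c', (τ c c' ∨ τ c' c) → c' ∈ s) (a : α) :
    (touchingGraph (SkelTouch τ Nr)).degree a ≤ m * D * m := by
  classical
  choose sN hsN using hm
  choose sT hsT using hD
  have hsub : (touchingGraph (SkelTouch τ Nr)).neighborFinset a ⊆ (sN a).biUnion fun c => (sT c).biUnion fun c' => sN c' := by
    intro y hy
    rw [_root_.SimpleGraph.mem_neighborFinset, touchingGraph_adj] at hy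
    obtain ⟨-, h | h⟩ := hy
    · obtain ⟨c, c', hca, hcc', hc'y⟩ := h
      exact Finset.mem_biUnion.2 ⟨c, (hsN a).2 c hca, Finset.mem_biUnion.2 ⟨c', (hsT c).2 c' (Or.inl hcc'), (hsN c').2 y (hsymm _ _ hc'y)⟩⟩
    · obtain ⟨c, c', hcy, hcc', hc'a⟩ := h
      exact Finset.mem_biUnion.2 ⟨c', (hsN a).2 c' hc'a, Finset.mem_biUnion.2 ⟨c, (hsT c').2 c (Or.inr hcc'), (hsN c).2 y (hsymm _ _ hcy)⟩⟩
  calc (touchingGraph (SkelTouch τ Nr)).degree a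
      = ((touchingGraph (SkelTouch τ Nr)).neighborFinset a).card := (_root_.SimpleGraph.card_neighborFinset_eq_degree _ a).symm
    _ ≤ ((sN a).biUnion fun c => (sT c).biUnion fun c' => sN c').card := Finset.card_le_card hsub
    _ ≤ ∑ c ∈ sN a, ((sT c).biUnion fun c' => sN c').card := Finset.card_biUnion_le
    _ ≤ ∑ c ∈ sN a, ∑ c' ∈ sT c, (sN c').card := Finset.sum_le_sum fun c _ => Finset.card_biUnion_le
    _ ≤ ∑ c ∈ sN a, ∑ _c' ∈ sT c, m := Finset.sum_le_sum fun c _ => Finset.sum_le_sum fun c' _ => (hsN c').1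
    _ ≤ ∑ _c ∈ sN a, D * m := Finset.sum_le_sum fun c _ => by
        rw [Finset.sum_const, smul_eq_mul]
        exact Nat.mul_le_mul_right _ (hsT c).1
    _ ≤ m * (D * m) := by
        rw [Finset.sum_const, smul_eq_mul]
        exact Nat.mul_le_mul_right _ (hsN a).1
    _ = m * D * m := (mul_assoc _ _ _).symm

/-- ★ **THE SEPARATED SKELETON FAMILY HAS AT MOST `|α| · (m·D·m)^{2(k−1)}` MEMBERS** (`card_animalCoverFamily_le` BY NAME on the degree bound).
[cite: Balaban1989LargeFieldII, (1.80) p.384, (1.84) p.386 (bookkeeping)] -/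
theorem card_sepAnimalCoverFamily_le [DecidableRel (touchingGraph (SkelTouch τ Nr)).Adj] (hsymm : ∀ a b, Nr a b → Nr b a) {m D : ℕ}
    (hm : ∀ b, ∃ s : Finset α, s.card ≤ m ∧ ∀ c, Nr c b → c ∈ s) (hD : ∀ c, ∃ s : Finset α, s.card ≤ D ∧ ∀ c', (τ c c' ∨ τ c' c) → c' ∈ s) (k : ℕ) :
    (sepAnimalCoverFamily τ Nr k).card ≤ Fintype.card α * (m * D * m) ^ (2 * (k - 1)) :=
  (Finset.card_le_card (sepAnimalCoverFamily_subset τ Nr k)).trans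
    (card_animalCoverFamily_le (SkelTouch τ Nr) (degree_touchingGraph_skelTouch_le τ Nr hsymm hm hD) k)

end Entropy

/-! ## §4  The torus instances (`τ = SiteTouch`, `D = 3^d`) -/

section Torus

variable {P : Params} {j : ℕ}

/-- **THE TWO-SIDED `SiteTouch`-NEIGHBOURHOOD OF A SITE HAS `≤ 3^d` SITES** (the translates `z + δ`, `δ ∈ {0, 1, −1}^d`; `siteTouch_sub_mem ∕ _mem'` BY NAME).
[cite: Balaban1989LargeFieldII, (1.84) p.386 (bookkeeping)] -/
theorem exists_cover_siteTouch (z : Site P j) :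
    ∃ s : Finset (Site P j), s.card ≤ 3 ^ P.d ∧ ∀ z', (SiteTouch z z' ∨ SiteTouch z' z) → z' ∈ s := by
  classical
  refine ⟨(Fintype.piFinset fun _ : Fin P.d => ({0, 1, -1} : Finset (ZMod (P.sitesPerDir j)))).image fun δ => z + δ, ?_, ?_⟩
  · calc ((Fintype.piFinset fun _ : Fin P.d => ({0, 1, -1} : Finset (ZMod (P.sitesPerDir j)))).image fun δ => z + δ).card
        ≤ (Fintype.piFinset fun _ : Fin P.d => ({0, 1, -1} : Finset (ZMod (P.sitesPerDir j)))).card := Finset.card_image_le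
      _ = ∏ _μ : Fin P.d, ({0, 1, -1} : Finset (ZMod (P.sitesPerDir j))).card := Fintype.card_piFinset _
      _ ≤ 3 ^ (Finset.univ : Finset (Fin P.d)).card := Finset.prod_le_pow_card _ _ 3 fun _ _ => Finset.card_le_three
      _ = 3 ^ P.d := by rw [Finset.card_univ, Fintype.card_fin]
  · intro z' hz'
    rw [Finset.mem_image]
    refine ⟨z' - z, Fintype.mem_piFinset.2 fun μ => ?_, add_sub_cancel z z'⟩
    rcases hz' with h | h
    · exact siteTouch_sub_mem z z' h μ
    · exact siteTouch_sub_mem' z z' h μ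

/-- ★ On the torus the separated skeleton family of a symmetric closeness of covering number `m` has `≤ |sites| · (m·3^d·m)^{2(k−1)}` members.
[cite: Balaban1989LargeFieldII, (1.80) p.384, (1.84) p.386 (bookkeeping)] -/
theorem card_sepAnimalCoverFamily_siteTouch_le (Nr : Site P j → Site P j → Prop) [DecidableRel (touchingGraph (SkelTouch (SiteTouch (P := P) (j := j)) Nr)).Adj]
    (hsymm : ∀ a b, Nr a b → Nr b a) {m : ℕ} (hm : ∀ b, ∃ s : Finset (Site P j), s.card ≤ m ∧ ∀ c, Nr c b → c ∈ s) (k : ℕ) :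
    (sepAnimalCoverFamily (SiteTouch (P := P) (j := j)) Nr k).card ≤ Fintype.card (Site P j) * (m * 3 ^ P.d * m) ^ (2 * (k - 1)) :=
  card_sepAnimalCoverFamily_le SiteTouch Nr hsymm hm exists_cover_siteTouch k

/-- ★★ **THE SKELETON COVER ON THE TORUS**: a large-field region `Z` of sites with a `SiteTouch`-component of `≥ thr lvl ≥ m·k` sites (`k ≥ 1`; `Nr` reflexive symmetric of
covering number `m`) contains the separated skeleton-connected `k`-set of some member of `sepAnimalCoverFamily SiteTouch Nr k`.
[cite: Balaban1989LargeFieldII, (1.84)–(1.88) pp.386–387 (bookkeeping)] -/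
theorem exists_mem_sepAnimalCoverFamily_siteTouch_of_hasBigComponent (Nr : Site P j → Site P j → Prop) (hrefl : ∀ a, Nr a a)
    (hsymm : ∀ a b, Nr a b → Nr b a) {m : ℕ} (hm : ∀ b, ∃ s : Finset (Site P j), s.card ≤ m ∧ ∀ c, Nr c b → c ∈ s) {k : ℕ} (hk : 1 ≤ k)
    {thr : ℕ → ℕ} {lvl : ℕ} (hthr : m * k ≤ thr lvl) {Z : Set (Site P j)} (h : HasBigComponent SiteTouch (bigOfCard thr lvl) Z) :
    ∃ p ∈ sepAnimalCoverFamily (SiteTouch (P := P) (j := j)) Nr k, (↑p.2 : Set (Site P j)) ⊆ Z := by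
  classical
  exact exists_mem_sepAnimalCoverFamily_of_hasBigComponent_card SiteTouch Nr siteTouch_refl hrefl hsymm hm hk hthr h

end Torus

end Literature.MathematicalPhysics.QuantumFieldTheory.Balaban1983to89.Node00

end
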